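import Literature.AlgebraicGeometry.Hyperkaehler.TranscendentalHodgeSimilitudesKugaSatake
import Literature.AlgebraicGeometry.Hyperkaehler.GeneralizedKummerTypeLefschetzStandardDegrees
import Literature.AlgebraicGeometry.Hyperkaehler.IrreducibleSymplecticOfDeformationType
import HarnessLib

/-!
# Varesco's Cor. 4.6 at print strength: transcendental Hodge similitudes into `X` are algebraic once Kuga–Satake holds on both sides and `B(X)` holds IN DEGREE TWO (Varesco, Math. Z. 305 (2023), Cor. 4.6; with Foster 2024 Cor. 71 for every `Kumⁿ`) — NAMED FACT + kernel

Layer `Literature/AlgebraicGeometry/Hyperkaehler`.  CITE record for the cross-ladder literature-typing layer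
(D-0088(4), tranche LT-H4, seat `hodge-lit-oqh-2`, generation 4), companion of
`TranscendentalHodgeSimilitudesKugaSatake` (Thm. 4.5 / Cor. 4.6 / Thm. 5.1, generation 3).  WHY A SECOND
RECORD OF COR. 4.6.  Generation 3 had to render the hypothesis "X satisfies the Lefschetz standard
conjecture in degree two" by the tree's ALL-DEGREES predicate `StandardConjectureBStar` (its docstring:
"a STRONGER hypothesis than print's degree-two statement …, so the record is WEAKER than print"), because
no degree-wise predicate existed; consequently its kernel `….of_kummerType_target` needs `n + 1` PRIME
(Foster's Cor. 2, full `B`).  Generation 4 supplied the degree-wise predicate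
`HodgeTheory.LefschetzStandardInDegree` (file `HodgeTheory/LefschetzStandardInDegree`) and Foster's Thm. 1 /
Cor. 71 on it (`Foster2024_lefschetzStandard_kummerType_degrees.degreeTwo`: `B` in degree two for EVERY
smooth projective variety of `Kumⁿ`-type, every `n ≥ 2`).  This file records Cor. 4.6 AS PRINTED (degree
two) and PROVES: (i) the generation-3 record is a COROLLARY of this one (`toLefschetzStandard` — so the
older, weaker def is formally subsumed; its users may be re-pointed by a later seat, it is not edited in
place); (ii) Varesco's §5 ¶1 sentence for targets of `Kumⁿ`-type for EVERY `n ≥ 2` — composite `n + 1`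
included (`n = 5, 7, 8, 9, 11, …`, the ladder's rung-H3 range) — by name from Voisin 2022 and Foster 2024
(`of_kummerType_target`), with the irreducible-symplectic clause on the target discharged by Beauville
1983 (`of_kummerType_target'`).

HONEST FRAMING: typed ≠ proved ≠ endorsed.  An IMPLICATION printed and proved in a refereed journal whose
antecedents are the tree's open Kuga–Satake predicate (both sides) and `B` in degree two for the target;
nothing here asserts HC ∕ HC_AV ∕ W₆ ∕ HC_Kum4Type, the Kuga–Satake Hodge conjecture, or `B(X)` for any `X`.

## Source (read at source this session; locators = files of the materialised arXiv text `paper:arxiv-2304.02519`)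

* [Var23] M. Varesco, *Hodge similarities, algebraic classes, and Kuga–Satake varieties*, Math. Z. 305
  (2023), art. 69 [`Varesco2023`; REFEREED].  §4 [p0016:L60–L65, verbatim]: "This shows that, if the
  Kuga–Satake correspondence is algebraic, then every Hodge similarity is algebraic after composing it with
  the Lefschetz isomorphism. The Lefschetz standard conjecture in degree two for `X` predicts that the
  inverse of `h_X^{2n-2} ∪ • : H²(X,ℚ) → H^{4n-2}(X,ℚ)` is algebraic. If `X` satisfies this conjecture,
  Theorem (main thm) gives the following: **Corollary 4.6.** Let `X` and `X'` be hyperkähler manifolds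
  satisfying the Kuga–Satake Hodge conjecture. Assume moreover that `X` satisfies the Lefschetz standard
  conjecture in degree two. Then, every Hodge similarity `ψ : T(X') → T(X)` is algebraic."  §5 [p0017:L7,
  verbatim]: "Let us start from the case of hyperkähler manifolds of generalized Kummer type. For these
  varieties the Kuga–Satake Hodge conjecture is proven in [Voisin 2022] and the Lefschetz standard
  conjecture in degree two has been proven in [Foster]."  Rem. 5.5 (different deformation types /
  dimensions allowed) and the conventions (Def. 1.2, Conj. 4.2, Rem. 4.1/4.3): module docstring of
  `TranscendentalHodgeSimilitudesKugaSatake`.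
* [Foster2024] J. Foster, Eur. J. Math. 10 (2024) 34, Cor. 71 [arXiv:2303.14327 p. 21: "the Lefschetz
  standard conjecture holds in degrees 2 and 3" for every `Kumⁿ`-type, REFEREED] — the tree's
  `Foster2024_lefschetzStandard_kummerType_degrees.degreeTwo`.

## Rendering

All binders and clauses are those of `Varesco2023_transcendentalHodgeSimilitude_algebraic_of_lefschetzStandard`
(see that file's "Rendering"), EXCEPT the Lefschetz hypothesis on the target `X₂`, which is now print's:
"the inverse of `h_X^{2n-2} ∪ •` is algebraic" = `B(X₂)` IN DEGREE TWO in André's `*_L`-form,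
`∀ η, HodgeTheory.LefschetzStandardInDegree (2 * n₂) X₂ η 2` (vacuous at non-polarisation classes; at a
polarisation class `η`: `*_L : H^{4n₂-2} → H²`, which for `2 ≤ 2n₂` IS the inverse Lefschetz isomorphism
`(L_η^{2n₂-2})⁻¹` — `lefschetzInvolution_lefschetzPow` — is induced by an algebraic correspondence).  "For
every class `η`" rather than "for the class of an ample divisor": implied by print for each polarisation
class (Foster §1.1: independent of the polarisation, [Kleiman]) and it is the spelling in which the tree
holds Foster's theorem; weaker-or-equal, never stronger.

## Content and D-0026 accounting

ONE named fact (+1): `Varesco2023_transcendentalHodgeSimilitude_algebraic_of_lefschetzStandardInDegreeTwo`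
(absent: `lean search 'LefschetzStandardInDegree'` finds only the predicate file and Foster's records).
Kernel (PROVED): `toLefschetzStandard` (this record ⟹ the generation-3 record, via
`lefschetzStandardInDegree_of_bStar`), `of_kummerType_target` (all `n ≥ 2`; Voisin + Foster Cor. 71),
`of_kummerType_target'` (target given as smooth projective of `Kumⁿ`-type; IHS by Beauville 1983).  NOT
here: any proof of the record; Thm. 5.1's "every Hodge MORPHISM" (its own record); the multiplier values.
-/

noncomputable section

open CategoryTheory _root_.AlgebraicGeometry
open Literature.AlgebraicTopology.SingularHomology

namespace Literature.AlgebraicGeometry.Hyperkaehler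

open HodgeTheory

/-- **Varesco 2023, Corollary 4.6 (print strength) — every Hodge similitude of rational transcendental
lattices `T(X') ⥲ T(X)` between projective hyperkähler varieties whose Kuga–Satake correspondences are
algebraic, the target `X` satisfying Grothendieck's `B(X)` IN DEGREE TWO, is induced by an algebraic cycle
on `X' × X` — ANY deformation types, ANY dimensions** (Rem. 5.5).  Print (the full sentence is quoted
verbatim in the module docstring): for `X`, `X'` hyperkähler with algebraic Kuga–Satake correspondences and
`X` satisfying `B` "in degree two", "every Hodge similarity `ψ : T(X') → T(X)` is algebraic."  Rendering:
binders of
`Varesco2023_lefschetzTwisted_transcendentalHodgeSimilitude_algebraic`, plus `B(X₂)` in degree `2`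
(`∀ η, LefschetzStandardInDegree (2 * n₂) X₂ η 2`: the inverse of `L_η^{2n₂-2} : H² ⥲ H^{4n₂-2}` is
induced by an algebraic correspondence, for every polarisation class `η`); conclusion: some
`T : H²(X₁(ℂ); ℂ) → H²(X₂(ℂ); ℂ)` induced by an algebraic cycle on `X₂ × X₁` agrees with `ψ` on
`transcendentalPart X₁ b₁`.  The generation-3 record `…_of_lefschetzStandard` (all-degrees `B`) is the
corollary `toLefschetzStandard`.  A THEOREM in print (REFEREED: Math. Z. 2023; unproved in the tree).
[cite: Varesco2023, Cor. 4.6 (§4, p0016:L60–L69) and Rem. 5.5 (§5)]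
[cite: Foster2024, §1.1 (B(X) in degree k; arXiv:2303.14327 p. 2)] -/
def Varesco2023_transcendentalHodgeSimilitude_algebraic_of_lefschetzStandardInDegreeTwo : Prop :=
  -- antecedents: the tree's open Kuga–Satake predicate (`X₁`, `X₂`) and `B(X₂)` in degree two; nothing is asserted
  ∀ (n₁ n₂ : ℕ), 1 ≤ n₁ → 1 ≤ n₂ →
  ∀ ⦃X₁ X₂ : Motives.SchemeOver ℂ⦄ (hX₁ : IsProjectiveIrreducibleSymplectic (2 * n₁) X₁)
    (hX₂ : IsProjectiveIrreducibleSymplectic (2 * n₂) X₂),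
    IsKSCorrespondenceAlgebraicHK n₁ hX₁.1 → IsKSCorrespondenceAlgebraicHK n₂ hX₂.1 →
    (∀ η : complexBetti X₂ 2, LefschetzStandardInDegree (2 * n₂) X₂ η 2) →
  ∀ (b₁ : complexBetti X₁ 2 →ₗ[ℂ] complexBetti X₁ 2 →ₗ[ℂ] ℂ)
    (b₂ : complexBetti X₂ 2 →ₗ[ℂ] complexBetti X₂ 2 →ₗ[ℂ] ℂ),
    IsFujikiForm n₁ X₁ b₁ → IsFujikiForm n₂ X₂ b₂ →
  ∀ (ψ : complexBetti X₁ 2 →ₗ[ℂ] complexBetti X₂ 2),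
    (∀ x ∈ transcendentalPart X₁ b₁, IsRationalClass x → IsRationalClass (ψ x)) →
    Set.BijOn ψ (transcendentalPart X₁ b₁) (transcendentalPart X₂ b₂) →
    (∀ (i j : ℕ), ∀ x ∈ transcendentalPart X₁ b₁,
      IsOfHodgeType (2 * n₁) X₁ 2 i j x → IsOfHodgeType (2 * n₂) X₂ 2 i j (ψ x)) →
    (∀ x ∈ transcendentalPart X₁ b₁, ∀ y ∈ transcendentalPart X₁ b₁, b₂ (ψ x) (ψ y) = b₁ x y) →
  ∃ T : complexBetti X₁ 2 →ₗ[ℂ] complexBetti X₂ 2,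
    IsAlgebraicCorrespondence (2 * n₂) (2 * n₁) X₂ X₁ T ∧ ∀ x ∈ transcendentalPart X₁ b₁, T x = ψ x

namespace Varesco2023_transcendentalHodgeSimilitude_algebraic_of_lefschetzStandardInDegreeTwo

/-- **The generation-3 record is a corollary**: `B(X₂)` in all degrees (`StandardConjectureBStar`) gives
`B(X₂)` in degree two (`lefschetzStandardInDegree_of_bStar`), so the print-strength record implies
`Varesco2023_transcendentalHodgeSimilitude_algebraic_of_lefschetzStandard`.  Kernel.
[cite: Varesco2023, Cor. 4.6 (§4)] [cite: Foster2024, §1.1 ("B(X) … holds if it holds in all degrees")] -/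
theorem toLefschetzStandard
    (h : Varesco2023_transcendentalHodgeSimilitude_algebraic_of_lefschetzStandardInDegreeTwo) :
    Varesco2023_transcendentalHodgeSimilitude_algebraic_of_lefschetzStandard :=
  fun n₁ n₂ hn₁ hn₂ _ _ hX₁ hX₂ hKS₁ hKS₂ hB ↦
    h n₁ n₂ hn₁ hn₂ hX₁ hX₂ hKS₁ hKS₂ (fun η ↦ lefschetzStandardInDegree_of_bStar (hB η) 2)

/-- **[Var23] §5 ¶1 for a target of `Kumⁿ`-type, EVERY `n ≥ 2` (kernel, with Voisin 2022 and Foster 2024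
Cor. 71):** a Hodge similitude `T(X₁) ⥲ T(X)` from ANY projective irreducible symplectic `X₁` satisfying
the Kuga–Satake statement to a projective irreducible symplectic `X` of `Kumⁿ`-type is induced by an
algebraic cycle — "For these varieties the Kuga–Satake Hodge conjecture is proven in [Voisin 2022] and the
Lefschetz standard conjecture in degree two has been proven in [Foster]".  Unlike the generation-3 kernel
(`….of_kummerType_target`, `n + 1` prime), no primality: Foster's Cor. 71 gives degree two for every `n`.
Kernel, modulo the three records. [cite: Varesco2023, §5 (first paragraph, p0017:L7) and Cor. 4.6]
[cite: Voisin2022FootnotesOGradyMarkman, Thm. 1.5 = Thm. 4.1] [cite: Foster2024, Cor. 71 (§5.1)] -/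
theorem of_kummerType_target
    (h : Varesco2023_transcendentalHodgeSimilitude_algebraic_of_lefschetzStandardInDegreeTwo)
    (hV : Voisin2022_kugaSatakeCorrespondence_algebraic_kummerType)
    (hF : Foster2024_lefschetzStandard_kummerType_degrees)
    {n₁ n : ℕ} (hn₁ : 1 ≤ n₁) (hn : 2 ≤ n) {X₁ X : Motives.SchemeOver ℂ}
    (hX₁ : IsProjectiveIrreducibleSymplectic (2 * n₁) X₁) (hX : IsProjectiveIrreducibleSymplectic (2 * n) X)
    (hKS₁ : IsKSCorrespondenceAlgebraicHK n₁ hX₁.1) (hKum : IsOfGeneralizedKummerType n X)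
    {b₁ : complexBetti X₁ 2 →ₗ[ℂ] complexBetti X₁ 2 →ₗ[ℂ] ℂ}
    {b : complexBetti X 2 →ₗ[ℂ] complexBetti X 2 →ₗ[ℂ] ℂ}
    (hb₁ : IsFujikiForm n₁ X₁ b₁) (hb : IsFujikiForm n X b)
    {ψ : complexBetti X₁ 2 →ₗ[ℂ] complexBetti X 2}
    (hψrat : ∀ x ∈ transcendentalPart X₁ b₁, IsRationalClass x → IsRationalClass (ψ x))
    (hψbij : Set.BijOn ψ (transcendentalPart X₁ b₁) (transcendentalPart X b))
    (hψH : ∀ (i j : ℕ), ∀ x ∈ transcendentalPart X₁ b₁,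
      IsOfHodgeType (2 * n₁) X₁ 2 i j x → IsOfHodgeType (2 * n) X 2 i j (ψ x))
    (hψiso : ∀ x ∈ transcendentalPart X₁ b₁, ∀ y ∈ transcendentalPart X₁ b₁, b (ψ x) (ψ y) = b₁ x y) :
    ∃ T : complexBetti X₁ 2 →ₗ[ℂ] complexBetti X 2,
      IsAlgebraicCorrespondence (2 * n) (2 * n₁) X X₁ T ∧ ∀ x ∈ transcendentalPart X₁ b₁, T x = ψ x :=
  h n₁ n hn₁ (by omega) hX₁ hX hKS₁ (hV n hn hX.1 hKum)
    (fun η ↦ Foster2024_lefschetzStandard_kummerType_degrees.degreeTwo hF hn hX.1 hKum η)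
    b₁ b hb₁ hb ψ hψrat hψbij hψH hψiso

/-- **Same, with the target given as a smooth projective variety of `Kumⁿ`-type** (the convention of
`Varesco2023_hodgeSimilitude_algebraic_kummerType` and of Foster's records): "irreducible symplectic" for
the target is Beauville 1983 Thm. 4 + Prop. 9 (`Beauville1983_irreducibleSymplectic_of_kummerType`).
Kernel, modulo the four records. [cite: Varesco2023, §5 (first paragraph) and Cor. 4.6]
[cite: Beauville1983, Thm. 4 and Prop. 9] -/
theorem of_kummerType_target'
    (h : Varesco2023_transcendentalHodgeSimilitude_algebraic_of_lefschetzStandardInDegreeTwo)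
    (hV : Voisin2022_kugaSatakeCorrespondence_algebraic_kummerType)
    (hF : Foster2024_lefschetzStandard_kummerType_degrees)
    (hB : Beauville1983_irreducibleSymplectic_of_kummerType)
    {n₁ n : ℕ} (hn₁ : 1 ≤ n₁) (hn : 2 ≤ n) {X₁ X : Motives.SchemeOver ℂ}
    (hX₁ : IsProjectiveIrreducibleSymplectic (2 * n₁) X₁) (hX : Motives.IsSmoothProjective (2 * n) X)
    (hKS₁ : IsKSCorrespondenceAlgebraicHK n₁ hX₁.1) (hKum : IsOfGeneralizedKummerType n X)
    {b₁ : complexBetti X₁ 2 →ₗ[ℂ] complexBetti X₁ 2 →ₗ[ℂ] ℂ}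
    {b : complexBetti X 2 →ₗ[ℂ] complexBetti X 2 →ₗ[ℂ] ℂ}
    (hb₁ : IsFujikiForm n₁ X₁ b₁) (hb : IsFujikiForm n X b)
    {ψ : complexBetti X₁ 2 →ₗ[ℂ] complexBetti X 2}
    (hψrat : ∀ x ∈ transcendentalPart X₁ b₁, IsRationalClass x → IsRationalClass (ψ x))
    (hψbij : Set.BijOn ψ (transcendentalPart X₁ b₁) (transcendentalPart X b))
    (hψH : ∀ (i j : ℕ), ∀ x ∈ transcendentalPart X₁ b₁,
      IsOfHodgeType (2 * n₁) X₁ 2 i j x → IsOfHodgeType (2 * n) X 2 i j (ψ x))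
    (hψiso : ∀ x ∈ transcendentalPart X₁ b₁, ∀ y ∈ transcendentalPart X₁ b₁, b (ψ x) (ψ y) = b₁ x y) :
    ∃ T : complexBetti X₁ 2 →ₗ[ℂ] complexBetti X 2,
      IsAlgebraicCorrespondence (2 * n) (2 * n₁) X X₁ T ∧ ∀ x ∈ transcendentalPart X₁ b₁, T x = ψ x :=
  of_kummerType_target h hV hF hn₁ hn hX₁ (hB n (by omega) hX hKum) hKS₁ hKum hb₁ hb hψrat hψbij hψH hψiso

end Varesco2023_transcendentalHodgeSimilitude_algebraic_of_lefschetzStandardInDegreeTwo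

end Literature.AlgebraicGeometry.Hyperkaehler

end
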